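import Summits.QuantumFields.QCD.Theses.QuarksAsStableAction
import Summits.QuantumFields.QCD.Theorems.QuarksAsStableActionWilsonQuarkStabilityTangentAlgebra
import Summits.QuantumFields.QCD.Theorems.QuarksAsStableActionWilsonQuarkStabilityTangentDelta
import Summits.QuantumFields.QCD.Theorems.QuarksAsStableActionWilsonQuarkStabilityTangentLinear

/-!
# Stub `stub_freeTangentBound_of` of line `Sketch` (idea `free-tangent-landau-chessboard`) — THEOREM A
(crux `Summit.QuantumFields.QCD.Theses.QuarksAsStableAction.WilsonQuarkStability`, item stmt-QuantumFields-9736,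
route route-QuantumFields-QuarksAsStableAction; the lead's own stub)

`stub_freeTangentBound_of : FreeTwistedFourier → APLatticeSum → FreeTangentBound` (the three propositions of the
lead's skeleton `Cruxes/WilsonQuarkStability/Lines/Sketch.lean`, stated unfolded): for every `L ≥ 1`, `|m| ≤ 1/2`,
every `U(3)` link field `V` on `(ℤ/L)⁴` and the constant central phase `ω = e^{iπ/L}·1` (antiperiodic quarks),
`‖det D[ω V]‖ ≤ exp(6752 · Σ_e (3 − Re tr V_e)) · ‖det D[ω]‖`, `D[X] = wilsonDirac ρ₃ X m 1`.

Proof (the free-tangent argument of the idea card, constants explicit):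
* tangent plane of the concave `log det` at the free Gram operator `H₁ = D[ω]ᴴD[ω]`
  (`norm_det_sq_le_exp_trace_mul`, file `…TangentAlgebra`): `‖det D_V‖² ≤ exp(Re Tr(H₁⁻¹H_V) − n) ‖det D₁‖²`,
  `det D₁ ≠ 0` from stub 1;
* expansion `Re Tr(H₁⁻¹H_V) − n = 2Re Tr(D₁⁻¹Δ) + Re Tr(H₁⁻¹ΔᴴΔ)` (`re_trace_gram_inv_mul_gram_sub_card`);
* quadratic term `≤ γ'·768·F` (`norm_trace_mul_conjTranspose_mul_self_le` with the entry bound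
  `‖(H₁⁻¹)_{pq}‖ ≤ γ' = L⁻⁴Σ_k 1/h(k)` from stub 1, and `Σ_p(Σ_q‖Δ_pq‖)² ≤ 768 F`, file `…TangentDelta`);
* linear term `≤ 76 γ' F` (`linear_term_le`, file `…TangentLinear`: the link coefficients are REAL by the
  reflection `k ↦ -k-1` of the antiperiodic grid, so `Im tr V_e` drops out);
* `γ' ≤ 16` (stub 2), so the exponent is `≤ 844·16·F = 2·6752·F`; take square roots.
Pure theorem file (no definitions).
-/

namespace Summit.QuantumFields.QCD.Cruxes.WilsonQuarkStability.FreeTangentLandauChessboard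

open Literature.MathematicalPhysics Literature.MathematicalPhysics.QuantumLattice
  Literature.MathematicalPhysics.QuantumFieldTheory Literature.Probability.LatticeModels
open Matrix Complex
open scoped Kronecker ComplexOrder ComplexConjugate BigOperators

noncomputable section

variable {L : ℕ} [NeZero L]

/-! ### Assembly: THEOREM A from the Fourier stub and the lattice-sum stub -/

/-- Entry bound for the free twisted Gram inverse from its Fourier representation:
`‖(H₁⁻¹)_{pq}‖ ≤ L⁻⁴ Σ_k 1/h(k)`. -/
theorem norm_gramInv_entry_le (h : TorusSite 4 L → ℝ) (hpos : ∀ k, 0 < h k)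
    (Hinv : Matrix (TorusSite 4 L × Fin 3 × Fin 4) (TorusSite 4 L × Fin 3 × Fin 4) ℂ)
    (hHinv : ∀ p q, Hinv p q = if p.2 = q.2 then ((L : ℂ) ^ 4)⁻¹ * ∑ k, torusChar k p.1 *
      conj (torusChar k q.1) / ((h k : ℝ) : ℂ) else 0)
    (p q : TorusSite 4 L × Fin 3 × Fin 4) :
    ‖Hinv p q‖ ≤ ((L : ℝ) ^ 4)⁻¹ * ∑ k, (h k)⁻¹ := by
  have hnn : 0 ≤ ((L : ℝ) ^ 4)⁻¹ * ∑ k, (h k)⁻¹ :=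
    mul_nonneg (by positivity) (Finset.sum_nonneg fun k _ => inv_nonneg.mpr (hpos k).le)
  rw [hHinv]
  split_ifs
  · rw [norm_mul, norm_inv, norm_pow, Complex.norm_natCast]
    refine mul_le_mul_of_nonneg_left ((norm_sum_le _ _).trans (Finset.sum_le_sum fun k _ => ?_))
      (by positivity)
    rw [norm_div, norm_mul, norm_torusChar, Complex.norm_conj, norm_torusChar, one_mul, Complex.norm_real,
      Real.norm_eq_abs, abs_of_pos (hpos k), one_div]
  · rw [norm_zero]; exact hnn

/-- `a² ≤ e^X b²` with `a, b ≥ 0` and `X ≤ 2Y` gives `a ≤ e^Y b`. -/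
theorem le_exp_mul_of_sq_le {a b X Y : ℝ} (ha : 0 ≤ a) (hb : 0 ≤ b) (h : a ^ 2 ≤ Real.exp X * b ^ 2)
    (hXY : X ≤ 2 * Y) : a ≤ Real.exp Y * b := by
  have h1 : a ^ 2 ≤ (Real.exp Y * b) ^ 2 := by
    calc a ^ 2 ≤ Real.exp X * b ^ 2 := h
      _ ≤ Real.exp (2 * Y) * b ^ 2 := mul_le_mul_of_nonneg_right (Real.exp_le_exp.mpr hXY) (sq_nonneg b)
      _ = (Real.exp Y * b) ^ 2 := by rw [mul_pow, ← Real.exp_nat_mul]; norm_num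
  exact (pow_le_pow_iff_left₀ ha (by positivity) two_ne_zero).mp h1

/-- **Stub 3 of line `Sketch` (`stub_freeTangentBound_of`, the lead's): THEOREM A of the line.**
From the Fourier diagonalisation of the free twisted Wilson–Dirac operator (stub 1, `FreeTwistedFourier`) and
the antiperiodic `d = 4` lattice sum (stub 2, `APLatticeSum`): for all `L ≥ 1`, `|m| ≤ 1/2`, every `U(3)` link
field `V` and the constant central phase `ω = e^{iπ/L}·1`,
`‖det D[ω V]‖ ≤ exp(6752 · Σ_e (3 − Re tr V_e)) · ‖det D[ω]‖`.
Proof: tangent inequality at the free Gram operator (`norm_det_sq_le_exp_trace_mul`), expansion of the tangent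
functional (`re_trace_gram_inv_mul_gram_sub_card`), quadratic term `≤ 768 γ' F` (`sum_sq_rowsum_delta_le`,
`norm_trace_mul_conjTranspose_mul_self_le`, `γ' = L⁻⁴Σ 1/h ≤ 16`), linear term `≤ 76 γ' F` (`linear_term_le`). -/
theorem stub_freeTangentBound_of :
    (∀ (L : ℕ) [NeZero L] (θ₀ m : ℝ) (ω : Matrix.unitaryGroup (Fin 3) ℂ),
      (ω : Matrix (Fin 3) (Fin 3) ℂ) = Complex.exp (θ₀ * I) • (1 : Matrix (Fin 3) (Fin 3) ℂ) →
      (∀ k : TorusSite 4 L, 0 < ((m + ∑ μ : Fin 4, (1 - Real.cos (2 * Real.pi * ((k μ).val : ℝ) / L + θ₀))) ^ 2 + ∑ μ : Fin 4, Real.sin (2 * Real.pi * ((k μ).val : ℝ) / L + θ₀) ^ 2)) →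
        (wilsonDirac (unitaryFundamentalRep (Fin 3) ℂ) (fun _ : Edge 4 L => ω) m 1).det ≠ 0 ∧
        (∀ p q : TorusSite 4 L × Fin 3 × Fin 4, ((wilsonDirac (unitaryFundamentalRep (Fin 3) ℂ) (fun _ : Edge 4 L => ω) m 1)ᴴ * (wilsonDirac (unitaryFundamentalRep (Fin 3) ℂ) (fun _ : Edge 4 L => ω) m 1))⁻¹ p q =
          if p.2 = q.2 then ((L : ℂ) ^ 4)⁻¹ * ∑ k : TorusSite 4 L, torusChar k p.1 * conj (torusChar k q.1) /
            ((((m + ∑ μ : Fin 4, (1 - Real.cos (2 * Real.pi * ((k μ).val : ℝ) / L + θ₀))) ^ 2 + ∑ μ : Fin 4, Real.sin (2 * Real.pi * ((k μ).val : ℝ) / L + θ₀) ^ 2) : ℝ) : ℂ) else 0) ∧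
        (∀ p q : TorusSite 4 L × Fin 3 × Fin 4, (wilsonDirac (unitaryFundamentalRep (Fin 3) ℂ) (fun _ : Edge 4 L => ω) m 1)⁻¹ p q =
          if p.2.1 = q.2.1 then ((L : ℂ) ^ 4)⁻¹ * ∑ k : TorusSite 4 L, torusChar k p.1 * conj (torusChar k q.1) *
            ((((m + ∑ μ : Fin 4, (1 - Real.cos (2 * Real.pi * ((k μ).val : ℝ) / L + θ₀))) : ℝ) : ℂ) • (1 : Matrix (Fin 4) (Fin 4) ℂ) + I • ∑ μ : Fin 4, ((Real.sin (2 * Real.pi * ((k μ).val : ℝ) / L + θ₀) : ℝ) : ℂ) • euclideanGamma μ)ᴴ p.2.2 q.2.2 / ((((m + ∑ μ : Fin 4, (1 - Real.cos (2 * Real.pi * ((k μ).val : ℝ) / L + θ₀))) ^ 2 + ∑ μ : Fin 4, Real.sin (2 * Real.pi * ((k μ).val : ℝ) / L + θ₀) ^ 2) : ℝ) : ℂ) else 0)) →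
    (∀ (L : ℕ) [NeZero L] (m : ℝ), |m| ≤ 1 / 2 →
      (∀ k : TorusSite 4 L, 0 < ((m + ∑ μ : Fin 4, (1 - Real.cos (2 * Real.pi * ((k μ).val : ℝ) / L + Real.pi / L))) ^ 2 + ∑ μ : Fin 4, Real.sin (2 * Real.pi * ((k μ).val : ℝ) / L + Real.pi / L) ^ 2)) ∧
        ((L : ℝ) ^ 4)⁻¹ * ∑ k : TorusSite 4 L, (((m + ∑ μ : Fin 4, (1 - Real.cos (2 * Real.pi * ((k μ).val : ℝ) / L + Real.pi / L))) ^ 2 + ∑ μ : Fin 4, Real.sin (2 * Real.pi * ((k μ).val : ℝ) / L + Real.pi / L) ^ 2))⁻¹ ≤ 16) →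
    (∃ ε C : ℝ, 0 < ε ∧ 0 ≤ C ∧ ∃ L₀ : ℕ, ∀ (L : ℕ) [NeZero L], L₀ ≤ L → ∀ m : ℝ, |m| ≤ ε →
      ∀ (ω : Matrix.unitaryGroup (Fin 3) ℂ),
        (ω : Matrix (Fin 3) (Fin 3) ℂ) = Complex.exp (↑(Real.pi / L) * I) • (1 : Matrix (Fin 3) (Fin 3) ℂ) →
        ∀ V : GaugeConfig 4 L (Matrix.unitaryGroup (Fin 3) ℂ),
          ‖(wilsonDirac (unitaryFundamentalRep (Fin 3) ℂ) (fun e => ω * V e) m 1).det‖ ≤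
            Real.exp (C * ∑ e : Edge 4 L, (3 - (((V e : Matrix.unitaryGroup (Fin 3) ℂ) :
              Matrix (Fin 3) (Fin 3) ℂ)).trace.re)) *
              ‖(wilsonDirac (unitaryFundamentalRep (Fin 3) ℂ)
                  (fun _ : Edge 4 L => ω) m 1).det‖) := by
  intro hF hS
  refine ⟨1 / 2, 6752, by norm_num, by norm_num, 0, fun L _ _ m hm ω hω V => ?_⟩
  -- the two stubs at this `L`, `m`
  obtain ⟨hpos, hsum⟩ := hS L m hm
  have hF' := hF L (Real.pi / L) m ω hω hpos
  obtain ⟨hdet, hHinv, hDinv⟩ := hF'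
  -- notation
  set DV := wilsonDirac (unitaryFundamentalRep (Fin 3) ℂ) (fun e => ω * V e) m 1 with hDV
  set D1 := wilsonDirac (unitaryFundamentalRep (Fin 3) ℂ) (fun _ : Edge 4 L => ω) m 1 with hD1
  set F : ℝ := ∑ e : Edge 4 L, (3 - (((V e : Matrix.unitaryGroup (Fin 3) ℂ) :
    Matrix (Fin 3) (Fin 3) ℂ)).trace.re) with hFdef
  set γ' : ℝ := ((L : ℝ) ^ 4)⁻¹ * ∑ k, ((fun k : TorusSite 4 L =>
    (m + ∑ μ, (1 - Real.cos (2 * Real.pi * ((k μ).val : ℝ) / L + Real.pi / L))) ^ 2 +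
      ∑ μ, Real.sin (2 * Real.pi * ((k μ).val : ℝ) / L + Real.pi / L) ^ 2) k)⁻¹ with hγ'
  have hFnn : 0 ≤ F := Finset.sum_nonneg fun e _ => by
    have := plaquetteDeficit_nonneg_aux (V e); linarith
  have hγnn : 0 ≤ γ' := mul_nonneg (by positivity) (Finset.sum_nonneg fun k _ => inv_nonneg.mpr (hpos k).le)
  -- A0
  have hA0 := norm_det_sq_le_exp_trace_mul DV D1 hdet
  -- expansion
  have hexp := re_trace_gram_inv_mul_gram_sub_card DV D1 hdet
  -- quadratic term
  have hquad : ((D1ᴴ * D1)⁻¹ * ((DV - D1)ᴴ * (DV - D1))).trace.re ≤ γ' * (768 * F) := by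
    refine (Complex.re_le_norm _).trans ?_
    refine (norm_trace_mul_conjTranspose_mul_self_le (fun p q =>
      norm_gramInv_entry_le _ hpos _ hHinv p q)).trans ?_
    exact mul_le_mul_of_nonneg_left (sum_sq_rowsum_delta_le hω V m) hγnn
  -- linear term
  have hlin : 2 * (D1⁻¹ * (DV - D1)).trace.re ≤ 76 * γ' * F := by
    have := linear_term_le (L := L) m hm
      (fun k μ => 2 * Real.pi * ((k μ).val : ℝ) / L + Real.pi / L) (fun k μ => rfl)
      (fun k => m + ∑ ν, (1 - Real.cos (2 * Real.pi * ((k ν).val : ℝ) / L + Real.pi / L)))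
      _ (fun k => rfl) (fun k => rfl) hpos _ (fun k => rfl) D1⁻¹ (DV - D1) hDinv V ?_
    · exact this
    · intro p q
      rw [hDV, hD1, wilsonDirac_phase_sub_apply]
      simp only [one_smul, rep_phase_mul_sub hω, rep_phase_mul_inv_sub hω]
  -- total exponent
  have hX : (((D1ᴴ * D1)⁻¹ * (DVᴴ * DV)).trace.re) - Fintype.card (TorusSite 4 L × Fin 3 × Fin 4) ≤
      2 * (6752 * F) := by
    rw [hexp]
    have h16 : γ' ≤ 16 := hsum
    nlinarith [hquad, hlin, hFnn, hγnn]
  exact le_exp_mul_of_sq_le (norm_nonneg _) (norm_nonneg _) hA0 hX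

end

end Summit.QuantumFields.QCD.Cruxes.WilsonQuarkStability.FreeTangentLandauChessboard
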